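import Mathlib
import Summits.HodgeConjecture.HodgeConjecture.Theses.NikulinTwinTransport

/-!
# Crux `TwinTwistorTransport` (stmt-HodgeConjecture-14393), line `one-line-totally-real-reach`:
# stub 2 `IdentityPrincipleFlat` — the identity principle from a totally real open set

An analytic function on a preconnected open set `U ⊆ ℂⁿ` that vanishes at all points of a non-empty
open set of REAL points `V ⊆ ℝⁿ` (with `V ⊆ U` along `ℝⁿ ⊂ ℂⁿ`) vanishes identically on `U`.

Proof (elementary, no power series): fix `a ∈ V` and a polydisc `P = {z : |z_i - a_i| < r}` around
`a` inside `U` whose real points lie in `V`.  By induction on `k` we show `f z = 0` for all `z ∈ P`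
whose coordinates of index `≥ k` are real: for `k = 0` this is the hypothesis; passing from `k` to
`k + 1`, freeze all coordinates but the `k`-th and apply the ONE-variable identity theorem
(`AnalyticOnNhd.eqOn_zero_of_preconnected_of_frequently_eq_zero`) on the disc `|w - a_k| < r`, on
which `w ↦ f(…, w, …)` is analytic and vanishes for real `w` by the induction hypothesis.  For `k = n`
this says `f = 0` on the open polydisc, and the several-variable identity theorem
(`AnalyticOnNhd.eqOn_zero_of_preconnected_of_eventuallyEq_zero`) propagates to `U`.

This is the registered stub `stub_identityPrinciple` (`IdentityPrincipleFlat`) of the line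
`Cruxes/TwinTwistorTransport/Lines/one-line-totally-real-reach.lean`, verbatim.  No definition, no
named-fact hypothesis, no sorry.
-/

set_option linter.dupNamespace false

noncomputable section

open Metric Set Filter Topology

namespace Summit.HodgeConjecture.HodgeConjecture.Theorems

namespace IdentityPrincipleFlat

/-- Freezing all coordinates but one is an analytic map `ℂ → ℂⁿ`. -/
theorem analyticAt_update {n : ℕ} (z : Fin n → ℂ) (i₀ : Fin n) (w : ℂ) :
    AnalyticAt ℂ (fun w : ℂ => Function.update z i₀ w) w := by
  refine analyticAt_pi_iff.mpr fun i => ?_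
  by_cases hi : i = i₀
  · subst hi
    simp_rw [Function.update_self]
    exact analyticAt_id
  · simp_rw [Function.update_of_ne hi]
    exact analyticAt_const

/-- The inductive core: on a polydisc around a real point whose real points are zeros of `f`, `f`
vanishes at every point whose coordinates of index `≥ k` are real — for every `k`. -/
theorem vanish_of_realTail {n : ℕ} (f : (Fin n → ℂ) → ℂ) (a : Fin n → ℝ) {r : ℝ} (hr : 0 < r)
    (hf : AnalyticOnNhd ℂ f (ball (fun i => (a i : ℂ)) r))
    (h0 : ∀ t : Fin n → ℝ, t ∈ ball a r → f (fun i => (t i : ℂ)) = 0) :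
    ∀ (k : ℕ) (z : Fin n → ℂ), z ∈ ball (fun i => (a i : ℂ)) r →
      (∀ i : Fin n, k ≤ i.val → (z i).im = 0) → f z = 0 := by
  intro k
  induction k with
  | zero =>
    intro z hz hreal
    -- all coordinates are real: `z` is a real point of the polydisc
    have hzre : (fun i => ((z i).re : ℂ)) = z := by
      funext i
      exact Complex.ext rfl (by simpa using (hreal i (Nat.zero_le _)).symm)
    have ht : (fun i => (z i).re) ∈ ball a r := by
      rw [mem_ball, dist_pi_lt_iff hr] at hz ⊢
      intro i
      have h := hz i
      rw [Real.dist_eq]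
      rw [Complex.dist_eq] at h
      calc |(z i).re - a i| = |(z i - (a i : ℂ)).re| := by simp
        _ ≤ ‖z i - (a i : ℂ)‖ := Complex.abs_re_le_norm _
        _ < r := h
    rw [← hzre]
    exact h0 _ ht
  | succ k ih =>
    intro z hz hreal
    by_cases hk : k < n
    · -- free the `k`-th coordinate and use the one-variable identity theorem on the disc
      set i₀ : Fin n := ⟨k, hk⟩ with hi₀
      have hmem : ∀ w : ℂ, w ∈ ball (a i₀ : ℂ) r →
          Function.update z i₀ w ∈ ball (fun i => (a i : ℂ)) r := by
        intro w hw
        rw [mem_ball, dist_pi_lt_iff hr] at hz ⊢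
        intro i
        by_cases hi : i = i₀
        · subst hi
          rw [Function.update_self]
          exact mem_ball.mp hw
        · rw [Function.update_of_ne hi]
          exact hz i
      -- `g w = f (z with z_{i₀} := w)` is analytic on the disc
      have hg : AnalyticOnNhd ℂ (fun w : ℂ => f (Function.update z i₀ w)) (ball (a i₀ : ℂ) r) :=
        fun w hw => (hf _ (hmem w hw)).comp (analyticAt_update z i₀ w)
      -- and vanishes at the real points of the disc (induction hypothesis)
      have hgreal : ∀ s : ℝ, |s - a i₀| < r → f (Function.update z i₀ (s : ℂ)) = 0 := by
        intro s hs
        have hsd : (s : ℂ) ∈ ball (a i₀ : ℂ) r := by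
          rw [mem_ball, Complex.dist_eq, ← Complex.ofReal_sub, Complex.norm_real, Real.norm_eq_abs]
          exact hs
        refine ih _ (hmem _ hsd) fun i hi => ?_
        by_cases hii : i = i₀
        · subst hii
          rw [Function.update_self]
          exact Complex.ofReal_im s
        · rw [Function.update_of_ne hii]
          refine hreal i ?_
          have : i.val ≠ k := fun h => hii (Fin.ext (by rw [h, hi₀]))
          omega
      -- hence frequently at the centre, hence everywhere on the disc
      have hfreq : ∃ᶠ w in 𝓝[≠] ((a i₀ : ℝ) : ℂ), f (Function.update z i₀ w) = 0 := by
        rw [Filter.frequently_iff]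
        intro U' hU'
        obtain ⟨ε, hε, hεU⟩ := Metric.mem_nhdsWithin_iff.mp hU'
        set s : ℝ := a i₀ + min ε r / 2 with hs
        have hmin : 0 < min ε r := lt_min hε hr
        refine ⟨(s : ℂ), hεU ⟨?_, ?_⟩, hgreal s ?_⟩
        · rw [mem_ball, Complex.dist_eq, ← Complex.ofReal_sub, Complex.norm_real, Real.norm_eq_abs, hs,
            add_sub_cancel_left, abs_of_pos (by positivity)]
          linarith [min_le_left ε r]
        · rw [mem_compl_iff, mem_singleton_iff, Complex.ofReal_inj, hs]
          linarith
        · rw [hs, add_sub_cancel_left, abs_of_pos (by positivity)]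
          linarith [min_le_right ε r]
      have hzero := hg.eqOn_zero_of_preconnected_of_frequently_eq_zero (convex_ball _ _).isPreconnected
        (mem_ball_self hr) hfreq
      have hzi : z i₀ ∈ ball (a i₀ : ℂ) r := by
        rw [mem_ball] at hz ⊢
        exact (dist_le_pi_dist z (fun i => (a i : ℂ)) i₀).trans_lt hz
      have := hzero hzi
      simpa [Function.update_eq_self] using this
    · -- no coordinate of index `≥ k` exists: the induction hypothesis applies as is
      exact ih z hz fun i hi => absurd (lt_of_lt_of_le i.isLt (le_trans (not_lt.mp hk) hi)) (lt_irrefl _)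

end IdentityPrincipleFlat

open IdentityPrincipleFlat in
/-- **`IdentityPrincipleFlat`** (crux `TwinTwistorTransport`, stmt-HodgeConjecture-14393, line
`one-line-totally-real-reach`, registered stub `stub_identityPrinciple`, verbatim): an analytic function
on a preconnected open `U ⊆ ℂⁿ` vanishing on a non-empty open set of real points `V` (`V ⊆ U` along
`ℝⁿ ⊂ ℂⁿ`) vanishes on `U`.  One-variable identity theorem coordinate by coordinate on a polydisc
around a real point, then the several-variable identity theorem. [folklore] -/
theorem twinTwistorTransport_identityPrincipleFlat :
    ∀ (n : ℕ) (f : (Fin n → ℂ) → ℂ) (U : Set (Fin n → ℂ)), IsOpen U → IsPreconnected U →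
      AnalyticOnNhd ℂ f U →
      ∀ V : Set (Fin n → ℝ), IsOpen V → V.Nonempty →
        (∀ t ∈ V, (fun i => (t i : ℂ)) ∈ U) → (∀ t ∈ V, f (fun i => (t i : ℂ)) = 0) →
        ∀ z ∈ U, f z = 0 := by
  intro n f U hU hUc hf V hV hVne hVU hfV
  obtain ⟨a, ha⟩ := hVne
  -- a polydisc around the real point `a` inside `U` whose real points lie in `V`
  obtain ⟨δ, hδ, hδV⟩ := Metric.isOpen_iff.mp hV a ha
  obtain ⟨ε, hε, hεU⟩ := Metric.isOpen_iff.mp hU _ (hVU a ha)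
  set r := min δ ε with hr_def
  have hr : 0 < r := lt_min hδ hε
  have hPU : ball (fun i => (a i : ℂ)) r ⊆ U :=
    (Metric.ball_subset_ball (min_le_right δ ε)).trans hεU
  have hfP : AnalyticOnNhd ℂ f (ball (fun i => (a i : ℂ)) r) := hf.mono hPU
  have h0 : ∀ t : Fin n → ℝ, t ∈ ball a r → f (fun i => (t i : ℂ)) = 0 :=
    fun t ht => hfV t (hδV (Metric.ball_subset_ball (min_le_left δ ε) ht))
  -- `f` vanishes on the whole polydisc (all `n` coordinates freed)
  have hP : ∀ z ∈ ball (fun i => (a i : ℂ)) r, f z = 0 := fun z hz =>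
    vanish_of_realTail f a hr hfP h0 n z hz fun i hi => absurd (lt_of_lt_of_le i.isLt hi) (lt_irrefl _)
  -- hence near `a`, hence on `U`
  have hev : f =ᶠ[𝓝 (fun i => (a i : ℂ))] 0 :=
    Filter.eventuallyEq_iff_exists_mem.mpr ⟨_, Metric.ball_mem_nhds _ hr, fun z hz => hP z hz⟩
  exact hf.eqOn_zero_of_preconnected_of_eventuallyEq_zero hUc (hVU a ha) hev

end Summit.HodgeConjecture.HodgeConjecture.Theorems

end
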